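import Summits.CriticalPhenomena.CardyFormulaZ2.Theorems.CardySusyWardWeakHolomorphyStaggeredArrivalCrux

/-!
# The crux `CardySusyWard.WeakHolomorphy` IS the weak, `∂φ`-tested, sublattice-staggered once-RIGHT law

Line `Sketch` of the crux `CardySusyWard.WeakHolomorphy` (stmt-CriticalPhenomena-11292), lead c5, stub
`stub_weakHolomorphyIffStaggeredOnceRight` (the once-RIGHT twin of `weakHolomorphy_iff_staggeredOnceLeft`, p158648).
At one mesh `δ` of a family `Λ`: `F_k = bondDartObservable (Λ δ) δ (1/3) (medialCornersAt p.1 p.2 k)`,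
`z_p = medialPoint δ (medialVertexOf p)`, `s_p = ±1` (horizontal / vertical),
`Z_t = onceChiralObs (Λ δ) δ (1/3) (medialVertexOf p) t` (`t = true`: LEFT, `false`: RIGHT), `λ = e^{−iπ/6}`, `λ̄ = e^{iπ/6}`,
`∂φ = (∂_xφ − i∂_yφ)/2`; the `∂φ`-tested staggered pairings (finsums over `p`) `W_4 = Σ ∂φ(z_p)·s_p·ΣₖF_k`,
`W_t = Σ ∂φ(z_p)·s_p·Z_t`, `W_in = Σ ∂φ(z_p)·s_p·in_p`.

* `arrivalCoeffL_ne_zero`: `A_L = 2 + λ² + 2λ + λ̄ ≠ 0` (`Re A_L = 5/2 + 3√3/2`, like `arrivalCoeffR_ne_zero`);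
* `staggeredOnceLeft_of_staggeredOnceRight`: given the free four-dart mode (`δ^{5/3} W_4 → 0` at every smooth compactly
  supported weight; supplied globally by `stub_staggeredFourDartFree`, p155223), `δ^{5/3} W_R → 0 ⟹ δ^{5/3} W_L → 0`, since
  eventually `W_4 = A_L W_L + A_R W_R` (`staggeredPairings_eventually_eq`, p158303) and `A_L ≠ 0` — the mirror image of
  `staggeredOnceRight_of_staggeredOnceLeft` (p158303, `A_R ≠ 0`);
* `staggeredOnceLeft_tendsto_iff_staggeredOnceRight`, `staggeredOnceRight_tendsto_iff_staggeredArrival`: the per-family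
  equivalences of the three staggered laws given the free mode;
* `weakHolomorphy_tendsto_iff_staggeredOnceRight` (per family) and `weakHolomorphy_iff_staggeredOnceRight` (global):
  the crux ⟺ the weak staggered once-RIGHT law, by `weakHolomorphy_iff_staggeredOnceLeft` and the per-family iff with the
  free mode `stub_staggeredFourDartFree Λ hΛ.2.2.2.2.2`; `stub_weakHolomorphyIffStaggeredOnceRight` is its registered
  one-line form.

References: Duminil-Copin–Smirnov arXiv:1109.1549 §8.3 (Conj. 8.7); Zhou arXiv:2409.03235 §4 eq. (102); crux workfiles
`Cruxes/WeakHolomorphy/{Disproof.lean §C–§D, Lines/Sketch.lean (v12), Lines/Sketch.md}`. -/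

noncomputable section

namespace Summit.CriticalPhenomena.CardyFormulaZ2.Theorems.WeakHolomorphy.SplitBypass

open scoped BigOperators Topology
open Filter Set MeasureTheory Complex
open _root_.Literature.Probability.LatticeModels
open _root_.Literature.Probability.RandomPlanarGeometry (DobrushinDomain)
open _root_.Literature.Barriers.CriticalPhenomena (medialCornersAt medialVertexOf)
open Summit.CriticalPhenomena.CardyFormulaZ2.Theorems.ParafermionPrecompact.Negative (IsFamily)

/-! ## The constant `A_L` -/

/-- `A_L = 2 + λ² + 2λ + λ̄ ≠ 0` (`λ = e^{-iπ/6}`, `λ̄ = e^{iπ/6}`): its real part is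
`2 + cos(π/3) + 3 cos(π/6) = 5/2 + 3√3/2 > 0` (the complex conjugate of `A_R`, cf. `arrivalCoeffR_ne_zero`). [folklore] -/
theorem arrivalCoeffL_ne_zero : (2 + Complex.exp (-(Real.pi / 6 : ℝ) * Complex.I) ^ 2 +
    2 * Complex.exp (-(Real.pi / 6 : ℝ) * Complex.I) + Complex.exp ((Real.pi / 6 : ℝ) * Complex.I)) ≠ 0 := by
  intro h
  have hre := congrArg Complex.re h
  rw [← Complex.ofReal_neg] at hre
  simp only [Complex.add_re, Complex.mul_re, sq, Complex.exp_ofReal_mul_I_re, Complex.exp_ofReal_mul_I_im,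
    Complex.re_ofNat, Complex.im_ofNat, Real.cos_neg, Real.sin_neg, Complex.zero_re, zero_mul, mul_neg, neg_mul,
    neg_neg] at hre
  rw [Real.cos_pi_div_six, Real.sin_pi_div_six] at hre
  nlinarith [Real.sqrt_nonneg 3, Real.sq_sqrt (show (0:ℝ) ≤ 3 by norm_num)]

/-! ## `∂φ` is a smooth compactly supported weight (local copies) -/

/-- If `∂φ(z) ≠ 0` then `z ∈ tsupport φ` (`fderiv` vanishes off `tsupport`). [folklore] -/
private theorem or_mem_tsupport_of_del_ne_zero (φ : ℂ → ℂ) {z : ℂ}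
    (hz : (fderiv ℝ φ z 1 - Complex.I * fderiv ℝ φ z Complex.I) / 2 ≠ 0) : z ∈ tsupport φ := by
  by_contra h
  exact hz (by rw [fderiv_of_notMem_tsupport ℝ h]; simp)

/-- `∂φ = (∂_xφ − i∂_yφ)/2` of a `C^∞` map `φ : ℂ → ℂ` is `C^∞`. [folklore] -/
private theorem or_del_contDiff (φ : ℂ → ℂ) (hφ : ContDiff ℝ (⊤ : ℕ∞) φ) :
    ContDiff ℝ (⊤ : ℕ∞) (fun z => (fderiv ℝ φ z 1 - Complex.I * fderiv ℝ φ z Complex.I) / 2) := by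
  have hd : ContDiff ℝ (⊤ : ℕ∞) (fderiv ℝ φ) := (contDiff_infty_iff_fderiv.1 hφ).2
  have h1 : ContDiff ℝ (⊤ : ℕ∞) (fun z => fderiv ℝ φ z 1) := hd.clm_apply contDiff_const
  have hI : ContDiff ℝ (⊤ : ℕ∞) (fun z => fderiv ℝ φ z Complex.I) := hd.clm_apply contDiff_const
  exact (h1.sub (contDiff_const.mul hI)).div_const 2

/-- `∂φ` of a compactly supported `φ : ℂ → ℂ` is compactly supported. [folklore] -/
private theorem or_del_hasCompactSupport (φ : ℂ → ℂ) (hc : HasCompactSupport φ) :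
    HasCompactSupport (fun z => (fderiv ℝ φ z 1 - Complex.I * fderiv ℝ φ z Complex.I) / 2) := by
  refine hc.mono' fun z hz => ?_
  rw [Function.mem_support] at hz
  exact or_mem_tsupport_of_del_ne_zero φ hz

/-! ## Pure algebra -/

/-- `W_L` from `W_4 = A_L W_L + A_R W_R` and `W_R`. [folklore] -/
private theorem or_solveL (AL AR T WL WR : ℂ) (hAL : AL ≠ 0) :
    AL⁻¹ * (T * (AL * WL + AR * WR) - AR * (T * WR)) = T * WL := by
  field_simp; ring

/-! ## Once-LEFT from once-RIGHT, and the per-family equivalences, given the free four-dart mode -/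

section PerFamily

variable (D : DobrushinDomain) (Λ : ℝ → DiscreteDobrushin) (hΛ : IsFamily D Λ) (φ : ℂ → ℂ) (hφ : ContDiff ℝ (⊤ : ℕ∞) φ)
  (hc : HasCompactSupport φ) (hs : tsupport φ ⊆ D.carrier)
  (hfree : ∀ (ψ : ℂ → ℂ), ContDiff ℝ (⊤ : ℕ∞) ψ → HasCompactSupport ψ →
    Tendsto (fun δ : ℝ => ((δ ^ ((5:ℝ) / 3) : ℝ) : ℂ) * ∑ᶠ p : Site 2 × Fin 2,
        ψ (medialPoint δ (medialVertexOf p)) * ((if p.2 = 0 then (1 : ℂ) else -1) *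
          (bondDartObservable (Λ δ) δ (1 / 3) (medialCornersAt p.1 p.2 0) +
            bondDartObservable (Λ δ) δ (1 / 3) (medialCornersAt p.1 p.2 1) +
            bondDartObservable (Λ δ) δ (1 / 3) (medialCornersAt p.1 p.2 2) +
            bondDartObservable (Λ δ) δ (1 / 3) (medialCornersAt p.1 p.2 3))))
      (𝓝[>] 0) (𝓝 0))
include hΛ hφ hc hs hfree

/-- **Staggered once-LEFT law from the staggered once-RIGHT law.** Along an admissible family `Λ` of `D` whose staggered
four-dart mode is free (`hfree`: the statement of `stub_staggeredFourDartFree` for `Λ`), for a smooth `φ` compactly supported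
in the domain: `δ^{5/3} W_R → 0 ⟹ δ^{5/3} W_L → 0`, since eventually `W_4 = A_L W_L + A_R W_R`
(`staggeredPairings_eventually_eq` at the weight `∂φ`), `δ^{5/3} W_4 → 0` (free mode at `ψ := ∂φ`) and `A_L ≠ 0`
(`arrivalCoeffL_ne_zero`) — the mirror image of `staggeredOnceRight_of_staggeredOnceLeft`. [folklore] -/
theorem staggeredOnceLeft_of_staggeredOnceRight
    (hR : Tendsto (fun δ : ℝ => ((δ ^ ((5:ℝ) / 3) : ℝ) : ℂ) * ∑ᶠ p : Site 2 × Fin 2,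
        (fderiv ℝ φ (medialPoint δ (medialVertexOf p)) 1 -
            Complex.I * fderiv ℝ φ (medialPoint δ (medialVertexOf p)) Complex.I) / 2 *
          ((if p.2 = 0 then (1 : ℂ) else -1) * onceChiralObs (Λ δ) δ (1 / 3) (medialVertexOf p) false))
      (𝓝[>] 0) (𝓝 0)) :
    Tendsto (fun δ : ℝ => ((δ ^ ((5:ℝ) / 3) : ℝ) : ℂ) * ∑ᶠ p : Site 2 × Fin 2,
        (fderiv ℝ φ (medialPoint δ (medialVertexOf p)) 1 -
            Complex.I * fderiv ℝ φ (medialPoint δ (medialVertexOf p)) Complex.I) / 2 *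
          ((if p.2 = 0 then (1 : ℂ) else -1) * onceChiralObs (Λ δ) δ (1 / 3) (medialVertexOf p) true))
      (𝓝[>] 0) (𝓝 0) := by
  have h4 := hfree _ (or_del_contDiff φ hφ) (or_del_hasCompactSupport φ hc)
  have h := (h4.sub (hR.const_mul (2 + Complex.exp ((Real.pi / 6 : ℝ) * Complex.I) ^ 2 +
    2 * Complex.exp ((Real.pi / 6 : ℝ) * Complex.I) + Complex.exp (-(Real.pi / 6 : ℝ) * Complex.I)))).const_mul
    (2 + Complex.exp (-(Real.pi / 6 : ℝ) * Complex.I) ^ 2 + 2 * Complex.exp (-(Real.pi / 6 : ℝ) * Complex.I) +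
      Complex.exp ((Real.pi / 6 : ℝ) * Complex.I))⁻¹
  simp only [mul_zero, sub_zero] at h
  refine h.congr' ?_
  filter_upwards [staggeredPairings_eventually_eq D Λ hΛ (tsupport φ) hc.isCompact hs
    (fun z => (fderiv ℝ φ z 1 - Complex.I * fderiv ℝ φ z Complex.I) / 2)
    (fun z hz => or_mem_tsupport_of_del_ne_zero φ hz)] with δ hδ
  rw [hδ.2]
  exact or_solveL _ _ _ _ _ arrivalCoeffL_ne_zero

/-- **Staggered once-LEFT law ⟺ staggered once-RIGHT law, per family and test function, given the free four-dart mode**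
(`staggeredOnceRight_of_staggeredOnceLeft`, `staggeredOnceLeft_of_staggeredOnceRight`). [folklore] -/
theorem staggeredOnceLeft_tendsto_iff_staggeredOnceRight :
    Tendsto (fun δ : ℝ => ((δ ^ ((5:ℝ) / 3) : ℝ) : ℂ) * ∑ᶠ p : Site 2 × Fin 2,
        (fderiv ℝ φ (medialPoint δ (medialVertexOf p)) 1 -
            Complex.I * fderiv ℝ φ (medialPoint δ (medialVertexOf p)) Complex.I) / 2 *
          ((if p.2 = 0 then (1 : ℂ) else -1) * onceChiralObs (Λ δ) δ (1 / 3) (medialVertexOf p) true))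
      (𝓝[>] 0) (𝓝 0) ↔
    Tendsto (fun δ : ℝ => ((δ ^ ((5:ℝ) / 3) : ℝ) : ℂ) * ∑ᶠ p : Site 2 × Fin 2,
        (fderiv ℝ φ (medialPoint δ (medialVertexOf p)) 1 -
            Complex.I * fderiv ℝ φ (medialPoint δ (medialVertexOf p)) Complex.I) / 2 *
          ((if p.2 = 0 then (1 : ℂ) else -1) * onceChiralObs (Λ δ) δ (1 / 3) (medialVertexOf p) false))
      (𝓝[>] 0) (𝓝 0) :=
  ⟨staggeredOnceRight_of_staggeredOnceLeft D Λ hΛ φ hφ hc hs hfree,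
    staggeredOnceLeft_of_staggeredOnceRight D Λ hΛ φ hφ hc hs hfree⟩

/-- **Staggered once-RIGHT law ⟺ staggered arrival law, per family and test function, given the free four-dart mode**
(the once-RIGHT twin of `staggeredOnceLeft_tendsto_iff_staggeredArrival`, through
`staggeredOnceLeft_tendsto_iff_staggeredOnceRight`). [folklore] -/
theorem staggeredOnceRight_tendsto_iff_staggeredArrival :
    Tendsto (fun δ : ℝ => ((δ ^ ((5:ℝ) / 3) : ℝ) : ℂ) * ∑ᶠ p : Site 2 × Fin 2,
        (fderiv ℝ φ (medialPoint δ (medialVertexOf p)) 1 -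
            Complex.I * fderiv ℝ φ (medialPoint δ (medialVertexOf p)) Complex.I) / 2 *
          ((if p.2 = 0 then (1 : ℂ) else -1) * onceChiralObs (Λ δ) δ (1 / 3) (medialVertexOf p) false))
      (𝓝[>] 0) (𝓝 0) ↔
    Tendsto (fun δ : ℝ => ((δ ^ ((5:ℝ) / 3) : ℝ) : ℂ) * ∑ᶠ p : Site 2 × Fin 2,
        (fderiv ℝ φ (medialPoint δ (medialVertexOf p)) 1 -
            Complex.I * fderiv ℝ φ (medialPoint δ (medialVertexOf p)) Complex.I) / 2 *
          (if p.2 = 0 then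
              bondDartObservable (Λ δ) δ (1 / 3) (medialCornersAt p.1 p.2 1) +
                bondDartObservable (Λ δ) δ (1 / 3) (medialCornersAt p.1 p.2 3)
            else
              -(bondDartObservable (Λ δ) δ (1 / 3) (medialCornersAt p.1 p.2 0) +
                bondDartObservable (Λ δ) δ (1 / 3) (medialCornersAt p.1 p.2 2))))
      (𝓝[>] 0) (𝓝 0) :=
  (staggeredOnceLeft_tendsto_iff_staggeredOnceRight D Λ hΛ φ hφ hc hs hfree).symm.trans
    (staggeredOnceLeft_tendsto_iff_staggeredArrival D Λ hΛ φ hφ hc hs hfree)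

end PerFamily

/-! ## The crux ⟺ the weak staggered once-RIGHT law -/

/-- **Per family: weak holomorphy of the vertex observable ⟺ the staggered once-RIGHT law.** Along an admissible family `Λ`
of the Dobrushin domain `D` and for a smooth test function `φ` compactly supported in the domain,
`δ^{5/3} Σ_z F_δ(z) ∂̄φ(z_δ) → 0` iff `δ^{5/3} Σ_p ∂φ(z_p)·s_p·Z_R(p) → 0`
(`weakHolomorphy_tendsto_iff_staggeredArrival` ∘ `staggeredOnceRight_tendsto_iff_staggeredArrival`, the free mode supplied by
`stub_staggeredFourDartFree`). [cite: DuminilCopinSmirnov2012Lattice, Conjecture 8.7] -/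
theorem weakHolomorphy_tendsto_iff_staggeredOnceRight (D : DobrushinDomain) (Λ : ℝ → DiscreteDobrushin) (hΛ : IsFamily D Λ)
    (φ : ℂ → ℂ) (hφ : ContDiff ℝ (⊤ : ℕ∞) φ) (hc : HasCompactSupport φ) (hs : tsupport φ ⊆ D.carrier) :
    Tendsto (fun δ : ℝ => ((δ ^ ((5:ℝ) / 3) : ℝ) : ℂ) * ∑ᶠ z : MedialVertex,
        Summit.CriticalPhenomena.CardyFormulaZ2.Theorems.ParafermionPrecompact.Negative.F Λ δ z *
          ((fderiv ℝ φ (medialPoint δ z) 1 + Complex.I * fderiv ℝ φ (medialPoint δ z) Complex.I) / 2))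
      (𝓝[>] 0) (𝓝 0) ↔
    Tendsto (fun δ : ℝ => ((δ ^ ((5:ℝ) / 3) : ℝ) : ℂ) * ∑ᶠ p : Site 2 × Fin 2,
        (fderiv ℝ φ (medialPoint δ (medialVertexOf p)) 1 -
            Complex.I * fderiv ℝ φ (medialPoint δ (medialVertexOf p)) Complex.I) / 2 *
          ((if p.2 = 0 then (1 : ℂ) else -1) * onceChiralObs (Λ δ) δ (1 / 3) (medialVertexOf p) false))
      (𝓝[>] 0) (𝓝 0) :=
  (weakHolomorphy_tendsto_iff_staggeredArrival D Λ hΛ φ hφ hc hs).trans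
    (staggeredOnceRight_tendsto_iff_staggeredArrival D Λ hΛ φ hφ hc hs (stub_staggeredFourDartFree Λ hΛ.2.2.2.2.2)).symm

/-- **The crux IS the weak staggered once-RIGHT law.** `WeakHolomorphy` holds iff, along every admissible square-lattice
discretisation family of every Dobrushin domain and for every smooth test function compactly supported in the domain,
`δ^{5/3} · Σ_p ∂φ(z_p) · s_p · Z_R(p) → 0` as `δ → 0⁺`, where
`Z_R(p) = onceChiralObs (Λ δ) δ (1/3) (medialVertexOf p) false = E[1{z_p visited exactly once, turning right} · e^{-iW_arrival/3}]`
is the once-visit RIGHT chiral sum of the exploration at `z_p`, `s_p = ±1` the sublattice sign, `∂φ = (∂_xφ − i∂_yφ)/2`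
(`weakHolomorphy_iff_staggeredOnceLeft` and, per family, `staggeredOnceLeft_tendsto_iff_staggeredOnceRight` with the free
mode `stub_staggeredFourDartFree`).  Together with the once-LEFT form: the open content of the crux is the weak staggered
vanishing of EITHER once-visit chirality class. [cite: DuminilCopinSmirnov2012Lattice, Conjecture 8.7] -/
theorem weakHolomorphy_iff_staggeredOnceRight :
    Summit.CriticalPhenomena.CardyFormulaZ2.Theses.CardySusyWard.WeakHolomorphy ↔
    ∀ (D : DobrushinDomain) (Λ : ℝ → DiscreteDobrushin), IsFamily D Λ → ∀ (φ : ℂ → ℂ),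
      ContDiff ℝ (⊤ : ℕ∞) φ → HasCompactSupport φ → tsupport φ ⊆ D.carrier →
        Tendsto (fun δ : ℝ => ((δ ^ ((5:ℝ) / 3) : ℝ) : ℂ) * ∑ᶠ p : Site 2 × Fin 2,
            (fderiv ℝ φ (medialPoint δ (medialVertexOf p)) 1 -
                Complex.I * fderiv ℝ φ (medialPoint δ (medialVertexOf p)) Complex.I) / 2 *
              ((if p.2 = 0 then (1 : ℂ) else -1) * onceChiralObs (Λ δ) δ (1 / 3) (medialVertexOf p) false))
          (𝓝[>] 0) (𝓝 0) := by
  rw [weakHolomorphy_iff_staggeredOnceLeft]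
  constructor
  · intro h D Λ hΛ φ hφ hc hs
    exact (staggeredOnceLeft_tendsto_iff_staggeredOnceRight D Λ hΛ φ hφ hc hs
      (stub_staggeredFourDartFree Λ hΛ.2.2.2.2.2)).1 (h D Λ hΛ φ hφ hc hs)
  · intro h D Λ hΛ φ hφ hc hs
    exact (staggeredOnceLeft_tendsto_iff_staggeredOnceRight D Λ hΛ φ hφ hc hs
      (stub_staggeredFourDartFree Λ hΛ.2.2.2.2.2)).2 (h D Λ hΛ φ hφ hc hs)

/-- **Registered one-line form of `weakHolomorphy_iff_staggeredOnceRight`**: the crux `WeakHolomorphy` is EQUIVALENT to the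
weak, `∂φ`-tested, sublattice-staggered once-RIGHT chiral law. [cite: DuminilCopinSmirnov2012Lattice, Conjecture 8.7] -/
theorem stub_weakHolomorphyIffStaggeredOnceRight : Summit.CriticalPhenomena.CardyFormulaZ2.Theses.CardySusyWard.WeakHolomorphy ↔ ∀ (D : DobrushinDomain) (Λ : ℝ → DiscreteDobrushin), IsFamily D Λ → ∀ (φ : ℂ → ℂ), ContDiff ℝ (⊤ : ℕ∞) φ → HasCompactSupport φ → tsupport φ ⊆ D.carrier → Tendsto (fun δ : ℝ => ((δ ^ ((5:ℝ) / 3) : ℝ) : ℂ) * ∑ᶠ p : Site 2 × Fin 2, (fderiv ℝ φ (medialPoint δ (medialVertexOf p)) 1 - Complex.I * fderiv ℝ φ (medialPoint δ (medialVertexOf p)) Complex.I) / 2 * ((if p.2 = 0 then (1 : ℂ) else -1) * onceChiralObs (Λ δ) δ (1 / 3) (medialVertexOf p) false)) (𝓝[>] 0) (𝓝 0) :=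
  weakHolomorphy_iff_staggeredOnceRight

end Summit.CriticalPhenomena.CardyFormulaZ2.Theorems.WeakHolomorphy.SplitBypass

end
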